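import Summits.CriticalPhenomena.PercolationContinuityZ3.Theorems.SahiAEOrthantGluing
import Summits.CriticalPhenomena.PercolationContinuityZ3.Theorems.SahiAEFiniteVersionPi

/-!
# The structure theorem in every dimension: corollaries (equivalent and product reference measures)

Support file of the Sahi cell (`prim-sahi`, typer seat, generation 23; `--supports stmt-CriticalPhenomena-4575`).
Theorems only (no definitions, no named facts, no sorries).

From `exists_measurable_supermodular_version_of_ae_unbounded` / `exists_measurable_mtp2_version_of_ae_unbounded`
(`SahiAEOrthantGluing.lean`: Lebesgue measure on `ℝ^ι`, every finite `ι`, no bounds):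

* `exists_measurable_supermodular_version_of_ae_of_equivalent_unbounded` — the additive theorem for every s-finite
  `μ ∼ λ` on `ℝ^ι`;
* `hasFiniteMTP2Versions_volume` — Lebesgue measure on `ℝ^ι` has the finite-version property of
  `SahiAEFiniteVersionTransport.lean` in EVERY dimension (g22: the plane only), hence, by the dimension-free transport
  of typer g21/g22 (`HasFiniteMTP2Versions.pi_of_volume'`: sigmoid/logit, quantile coupling, a fixed section of the
  randomised probability integral transform for the atoms),
* `hasFiniteMTP2Versions_pi` — **every finite product of σ-finite measures on `ℝ` (atoms allowed) has the
  finite-version property**: a measurable `f : ℝ^ι → (0, ∞)`, MTP₂ on `(⊗ρᵢ) ⊗ (⊗ρᵢ)`-almost every pair, has a finite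
  Borel version MTP₂ at EVERY pair (`exists_measurable_mtp2_version_of_ae_pi_unbounded`, and the form with
  `0 < f < ∞` only almost everywhere); the version may vanish off the essential box of `⊗ρᵢ`, which is unavoidable
  (`Plane.no_real_supermodular_version_neg_div`);
* `isBoxTP2_iff_exists_mtp2_density_pi` / `isBoxTP2_iff_exists_pos_mtp2_density` — **MTP₂ laws are exactly the laws
  with an everywhere-MTP₂ Borel density**: a finite law with an a.e.-positive density w.r.t. a product of locally
  finite measures on `ℝ` (resp. Lebesgue measure) is TP₂ on closed boxes (⟺ set-TP₂ ⟺ affiliated, typer g12/g16)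
  iff it has a Borel density, finite (resp. with values in `(0, ∞)`), MTP₂ at EVERY pair — Karlin–Rinott's pointwise
  definition and the almost-everywhere one agree with no regularity or boundedness assumption, in every dimension
  (g21: bounded away from `0, ∞`; g22: the plane).

No sorries, no new axioms.
-/

noncomputable section

namespace Summit.CriticalPhenomena.PercolationContinuityZ3.Theorems.SahiAEFourFunctions

open MeasureTheory Set Filter Topology Function
open Summit.CriticalPhenomena.PercolationContinuityZ3.Theorems.SahiBoxTP2 (IsBoxTP2)
open scoped ENNReal NNReal

variable {ι : Type*} [Fintype ι]

/-- **The additive theorem under a reference measure equivalent to Lebesgue measure.**  For an s-finite `μ` on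
`ℝ^ι` with `μ ≪ λ ≪ μ`, a measurable `φ` supermodular on `μ ⊗ μ`-almost every pair has a Borel version (`μ`-a.e.,
equivalently `λ`-a.e.) supermodular at every pair. [this work] -/
theorem exists_measurable_supermodular_version_of_ae_of_equivalent_unbounded (μ : Measure (ι → ℝ)) [SFinite μ]
    (hμ : μ ≪ volume) (hν : volume ≪ μ) (φ : (ι → ℝ) → ℝ) (hφ : Measurable φ)
    (hsm : ∀ᵐ p ∂μ.prod μ, φ p.1 + φ p.2 ≤ φ (p.1 ⊓ p.2) + φ (p.1 ⊔ p.2)) :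
    ∃ ψ : (ι → ℝ) → ℝ, Measurable ψ ∧ ψ =ᵐ[μ] φ ∧ ∀ x y, ψ x + ψ y ≤ ψ (x ⊓ y) + ψ (x ⊔ y) := by
  have hsm' : ∀ᵐ p ∂(volume : Measure (ι → ℝ)).prod volume, φ p.1 + φ p.2 ≤ φ (p.1 ⊓ p.2) + φ (p.1 ⊔ p.2) :=
    (hν.prod hν).ae_le hsm
  obtain ⟨ψ, hψm, hψφ, hψsm⟩ := exists_measurable_supermodular_version_of_ae_unbounded φ hφ hsm'
  exact ⟨ψ, hψm, hμ.ae_le hψφ, hψsm⟩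

/-- **The multiplicative theorem under a reference measure equivalent to Lebesgue measure.** [this work] -/
theorem exists_measurable_mtp2_version_of_ae_of_equivalent_unbounded (μ : Measure (ι → ℝ)) [SFinite μ]
    (hμ : μ ≪ volume) (hν : volume ≪ μ) (f : (ι → ℝ) → ℝ≥0∞) (hf : Measurable f)
    (hfin : ∀ᵐ x ∂μ, f x ≠ 0 ∧ f x ≠ ∞)
    (hMTP : ∀ᵐ p ∂μ.prod μ, f p.1 * f p.2 ≤ f (p.1 ⊓ p.2) * f (p.1 ⊔ p.2)) :
    ∃ F : (ι → ℝ) → ℝ≥0∞, Measurable F ∧ (∀ x, F x ≠ 0 ∧ F x ≠ ∞) ∧ F =ᵐ[μ] f ∧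
      ∀ x y, F x * F y ≤ F (x ⊓ y) * F (x ⊔ y) := by
  obtain ⟨F, hFm, hFb, hFf, hFmtp⟩ :=
    exists_measurable_mtp2_version_of_ae_unbounded' f hf (hν.ae_le hfin) ((hν.prod hν).ae_le hMTP)
  exact ⟨F, hFm, hFb, hμ.ae_le hFf, hFmtp⟩

/-- **Lebesgue measure on `ℝ^ι` has the finite-version property in every dimension** (g22: the plane).
[this work] -/
theorem hasFiniteMTP2Versions_volume : HasFiniteMTP2Versions (volume : Measure (ι → ℝ)) := by
  intro f hf h0 hT hMTP
  obtain ⟨F, hFm, hFb, hFf, hFmtp⟩ := exists_measurable_mtp2_version_of_ae_unbounded f hf h0 hT hMTP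
  exact ⟨F, hFm, fun x => (hFb x).2, hFf, hFmtp⟩

/-- **Every finite product of σ-finite measures on `ℝ` has the finite-version property** (atoms allowed; transport
of typer g21/g22). [this work] -/
theorem hasFiniteMTP2Versions_pi (ρ : ι → Measure ℝ) [∀ i, SigmaFinite (ρ i)] :
    HasFiniteMTP2Versions (Measure.pi ρ) :=
  hasFiniteMTP2Versions_volume.pi_of_volume' ρ

/-- **The structure theorem under a product reference measure, every dimension.**  For σ-finite `ρᵢ` on `ℝ` (atoms
allowed) and a measurable `f : ℝ^ι → (0, ∞)` (finite, non-zero, NO bounds) which is MTP₂ on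
`(⊗ρᵢ) ⊗ (⊗ρᵢ)`-almost every pair, there is a finite Borel version `F = f` a.e. with `F(x) F(y) ≤ F(x ∧ y) F(x ∨ y)` at
EVERY pair (the version may vanish off the essential box of `⊗ρᵢ`). [this work] -/
theorem exists_measurable_mtp2_version_of_ae_pi_unbounded (ρ : ι → Measure ℝ) [∀ i, SigmaFinite (ρ i)]
    (f : (ι → ℝ) → ℝ≥0∞) (hf : Measurable f) (h0 : ∀ x, f x ≠ 0) (hT : ∀ x, f x ≠ ∞)
    (hMTP : ∀ᵐ p ∂(Measure.pi ρ).prod (Measure.pi ρ), f p.1 * f p.2 ≤ f (p.1 ⊓ p.2) * f (p.1 ⊔ p.2)) :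
    ∃ F : (ι → ℝ) → ℝ≥0∞, Measurable F ∧ (∀ x, F x ≠ ∞) ∧ F =ᵐ[Measure.pi ρ] f ∧
      ∀ x y, F x * F y ≤ F (x ⊓ y) * F (x ⊔ y) :=
  hasFiniteMTP2Versions_pi ρ f hf h0 hT hMTP

/-- The same with `0 < f < ∞` assumed only almost everywhere. [this work] -/
theorem exists_measurable_mtp2_version_of_ae_pi_unbounded' (ρ : ι → Measure ℝ) [∀ i, SigmaFinite (ρ i)]
    (f : (ι → ℝ) → ℝ≥0∞) (hf : Measurable f) (hfin : ∀ᵐ x ∂Measure.pi ρ, f x ≠ 0 ∧ f x ≠ ∞)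
    (hMTP : ∀ᵐ p ∂(Measure.pi ρ).prod (Measure.pi ρ), f p.1 * f p.2 ≤ f (p.1 ⊓ p.2) * f (p.1 ⊔ p.2)) :
    ∃ F : (ι → ℝ) → ℝ≥0∞, Measurable F ∧ (∀ x, F x ≠ ∞) ∧ F =ᵐ[Measure.pi ρ] f ∧
      ∀ x y, F x * F y ≤ F (x ⊓ y) * F (x ⊔ y) := by
  set G : Set (ι → ℝ) := {x | f x ≠ 0 ∧ f x ≠ ∞} with hG
  have mG : MeasurableSet G :=
    (hf (measurableSet_singleton 0)).compl.inter (hf (measurableSet_singleton ∞)).compl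
  set g : (ι → ℝ) → ℝ≥0∞ := G.piecewise f (fun _ => 1) with hg
  have hgm : Measurable g := hf.piecewise mG measurable_const
  have hg_of_mem : ∀ x ∈ G, g x = f x := fun x hx => Set.piecewise_eq_of_mem _ _ _ hx
  have hg_of_not_mem : ∀ x ∉ G, g x = 1 := fun x hx => Set.piecewise_eq_of_notMem _ _ _ hx
  have hg0 : ∀ x, g x ≠ 0 := fun x => by
    by_cases hx : x ∈ G
    · rw [hg_of_mem x hx]; exact hx.1
    · rw [hg_of_not_mem x hx]; exact one_ne_zero
  have hgT : ∀ x, g x ≠ ∞ := fun x => by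
    by_cases hx : x ∈ G
    · rw [hg_of_mem x hx]; exact hx.2
    · rw [hg_of_not_mem x hx]; exact ENNReal.one_ne_top
  have hgf : g =ᵐ[Measure.pi ρ] f := by
    filter_upwards [hfin] with x hx using hg_of_mem x hx
  have hgMTP : ∀ᵐ p ∂(Measure.pi ρ).prod (Measure.pi ρ), g p.1 * g p.2 ≤ g (p.1 ⊓ p.2) * g (p.1 ⊔ p.2) := by
    filter_upwards [hMTP, ae_prod_mem_inf_sup_of_sigmaFinite ρ (G := G) hfin] with p hp hG4
    rw [hg_of_mem _ hG4.1.1, hg_of_mem _ hG4.1.2, hg_of_mem _ hG4.2.1, hg_of_mem _ hG4.2.2]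
    exact hp
  obtain ⟨F, hFm, hFb, hFg, hFmtp⟩ := hasFiniteMTP2Versions_pi ρ g hgm hg0 hgT hgMTP
  exact ⟨F, hFm, hFb, hFg.trans hgf, hFmtp⟩

/-! ### MTP₂ laws and everywhere-MTP₂ densities -/

/-- **A box-TP₂ law with an a.e.-positive integrable density has an everywhere-MTP₂ Borel density**, for any product
of locally finite reference measures on `ℝ`, in every dimension, with no bounds on the density. [this work] -/
theorem exists_mtp2_density_of_isBoxTP2_pi_unbounded (ρ : ι → Measure ℝ) [∀ i, IsLocallyFiniteMeasure (ρ i)]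
    (f : (ι → ℝ) → ℝ≥0∞) (hf : Measurable f) (hint : ∫⁻ z, f z ∂Measure.pi ρ ≠ ∞)
    (hfin : ∀ᵐ x ∂Measure.pi ρ, f x ≠ 0 ∧ f x ≠ ∞) (h : IsBoxTP2 ((Measure.pi ρ).withDensity f)) :
    ∃ F : (ι → ℝ) → ℝ≥0∞, Measurable F ∧ (∀ x, F x ≠ ∞) ∧
      (Measure.pi ρ).withDensity F = (Measure.pi ρ).withDensity f ∧ ∀ x y, F x * F y ≤ F (x ⊓ y) * F (x ⊔ y) := by
  have hae := (isBoxTP2_withDensity_pi_iff_ae ρ f hf hint).1 h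
  obtain ⟨F, hFm, hFb, hFf, hFmtp⟩ := exists_measurable_mtp2_version_of_ae_pi_unbounded' ρ f hf hfin hae
  exact ⟨F, hFm, hFb, withDensity_congr_ae hFf, hFmtp⟩

/-- **Box-TP₂ ⟺ an everywhere-MTP₂ finite Borel density**, for finite laws with an a.e.-positive density w.r.t. a
product of locally finite measures on `ℝ`, every dimension, no bounds. [this work] -/
theorem isBoxTP2_iff_exists_mtp2_density_pi (ρ : ι → Measure ℝ) [∀ i, IsLocallyFiniteMeasure (ρ i)]
    (f : (ι → ℝ) → ℝ≥0∞) (hf : Measurable f) (hint : ∫⁻ z, f z ∂Measure.pi ρ ≠ ∞)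
    (hfin : ∀ᵐ x ∂Measure.pi ρ, f x ≠ 0 ∧ f x ≠ ∞) :
    IsBoxTP2 ((Measure.pi ρ).withDensity f) ↔
      ∃ F : (ι → ℝ) → ℝ≥0∞, Measurable F ∧ (∀ x, F x ≠ ∞) ∧
        (Measure.pi ρ).withDensity F = (Measure.pi ρ).withDensity f ∧ ∀ x y, F x * F y ≤ F (x ⊓ y) * F (x ⊔ y) := by
  refine ⟨exists_mtp2_density_of_isBoxTP2_pi_unbounded ρ f hf hint hfin, fun ⟨F, hFm, _, hFeq, hFmtp⟩ => ?_⟩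
  rw [← hFeq]
  exact isBoxTP2_withDensity_pi_of_ae ρ F hFm (Eventually.of_forall fun p => hFmtp p.1 p.2)

/-- **Box-TP₂ ⟺ an everywhere-MTP₂ Borel density with values in `(0, ∞)`**, for finite laws on `ℝ^ι` with an
a.e.-positive Lebesgue density, every dimension, no bounds (g22: `Plane.isBoxTP2_iff_exists_tp2_density_plane`).
[this work] -/
theorem isBoxTP2_iff_exists_pos_mtp2_density (f : (ι → ℝ) → ℝ≥0∞) (hf : Measurable f)
    (hint : ∫⁻ z, f z ∂(volume : Measure (ι → ℝ)) ≠ ∞)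
    (hfin : ∀ᵐ x ∂(volume : Measure (ι → ℝ)), f x ≠ 0 ∧ f x ≠ ∞) :
    IsBoxTP2 ((volume : Measure (ι → ℝ)).withDensity f) ↔
      ∃ F : (ι → ℝ) → ℝ≥0∞, Measurable F ∧ (∀ x, F x ≠ 0 ∧ F x ≠ ∞) ∧
        (volume : Measure (ι → ℝ)).withDensity F = (volume : Measure (ι → ℝ)).withDensity f ∧
        ∀ x y, F x * F y ≤ F (x ⊓ y) * F (x ⊔ y) := by
  constructor
  · intro h
    have hae : ∀ᵐ p ∂(volume : Measure (ι → ℝ)).prod volume, f p.1 * f p.2 ≤ f (p.1 ⊓ p.2) * f (p.1 ⊔ p.2) := by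
      have h' := (isBoxTP2_withDensity_pi_iff_ae (fun _ : ι => (volume : Measure ℝ)) f hf
        (by rw [← volume_pi]; exact hint)).1 (by rw [← volume_pi]; exact h)
      rwa [← volume_pi] at h'
    obtain ⟨F, hFm, hFb, hFf, hFmtp⟩ := exists_measurable_mtp2_version_of_ae_unbounded' f hf hfin hae
    exact ⟨F, hFm, hFb, withDensity_congr_ae hFf, hFmtp⟩
  · rintro ⟨F, hFm, -, hFeq, hFmtp⟩
    rw [← hFeq, volume_pi]
    exact isBoxTP2_withDensity_pi_of_ae (fun _ : ι => (volume : Measure ℝ)) F hFm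
      (Eventually.of_forall fun p => hFmtp p.1 p.2)

end Summit.CriticalPhenomena.PercolationContinuityZ3.Theorems.SahiAEFourFunctions
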